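import Literature.Geometry.Kaehler.AnalyticSet
import HarnessLib

/-!
# Pure dimension of irreducible analytic sets (trunk `Kaehler`, item K6 / D8)

This file reduces the named fact `Literature.Geometry.Kaehler.IsIrreducibleAnalyticSet.exists_hasPureCodim` of
`Literature/Geometry/Kaehler/AnalyticSet.lean` (*an irreducible analytic subset of a complex manifold has
pure codimension*, [Chirka1989, §5.3, opening paragraph, p. 54]: "By p.5.2, irreducible analytic sets are
homogeneous in dimension") to its two inputs in the source, following the printed argument:

* the density of regular points, `Literature.Geometry.Kaehler.IsAnalyticSet.subset_closure_regularLocus`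
  ([Chirka1989, §2.3 Thm.]; a named fact of `AnalyticSet.lean`);
* the **decomposition by dimension** [Chirka1989, §5.2 Thm. 1]: the closure of the set of points of `A` of
  dimension `k` is empty or a pure `k`-dimensional analytic subset — vendored here as the named fact
  `Literature.Geometry.Kaehler.IsAnalyticSet.hasPureCodim_closure_regularLocusOfCodim` (see its docstring for the transcription
  in terms of the regular points of a given codimension, `Literature.Geometry.Kaehler.regularLocusOfCodim`).

From these, `Literature.Geometry.Kaehler.IsIrreducibleAnalyticSet.exists_hasPureCodim_of` proves that an irreducible analytic set
has pure codimension (`Z ⊆ cl (reg Z) = ⋃_{p ≤ dim E} cl (reg_p Z)` is a finite union of analytic sets, so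
`Z` lies in one of them), and `Literature.Geometry.Kaehler.IsIrreducibleAnalyticSet.exists_hasPureCodim_of_facts` records the
implication between the named facts
`subset_closure_regularLocus I M → hasPureCodim_closure_regularLocusOfCodim I M → exists_hasPureCodim I M`.
The proof in print of [Chirka1989, §5.2 Thm. 1] rests on the local theory of analytic sets (Weierstrass
preparation, proper projections, analytic covers: [Chirka1989, §§1, 3, 4.3, 5.1]), none of which is in
Mathlib at the pin of this tree; it is the remaining input for a proof of `exists_hasPureCodim`.

Contents:

* `Literature.regularLocusOfCodim I Z p` — the points of `Z` regular of codimension `p`, with its elementary API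
  (`regularLocus` is the finite union of the `regularLocusOfCodim · p`, `p ≤ dim E`, on a manifold
  modelled on a finite-dimensional space; `HasPureCodim` restated);
* `Literature.Geometry.Kaehler.IsIrreducibleAnalyticSet.exists_subset_of_subset_biUnion` — an irreducible analytic set contained in
  a finite union of analytic sets lies in one of them;
* the named fact and the two reduction theorems above.

## References

* E. M. Chirka, *Complex Analytic Sets*, Kluwer (1989), §2.3–2.4 (regular points, dimension), §5.2
  Thm. 1 (decomposition by dimension), §5.3 (irreducibility) [Chirka1989].
* P. Griffiths, J. Harris, *Principles of Algebraic Geometry* (1978), Ch. 0 §2.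
-/

open scoped Manifold ContDiff Topology
open Set

namespace Literature.Geometry.Kaehler

variable {E : Type*} [NormedAddCommGroup E] [NormedSpace ℂ E]
  {H : Type*} [TopologicalSpace H] {I : ModelWithCorners ℂ E H}
  {M : Type*} [TopologicalSpace M] [ChartedSpace H M]

/-! ### Regular points of a given codimension -/

variable (I) in
/-- `regularLocusOfCodim I Z p`: the points of `Z` which are regular of codimension `p`
(`IsRegularPointOfCodim`), i.e. near which `Z` is a complex submanifold of codimension `p`. In
the notation of Chirka (`n = dim M`), this is `A_(n-p) ∩ reg A`, the set of regular points `z` with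
`dim_z A = n - p`. [Chirka, *Complex Analytic Sets*, §2.3–2.4] [folklore] -/
def regularLocusOfCodim (Z : Set M) (p : ℕ) : Set M :=
  {x ∈ Z | IsRegularPointOfCodim I Z p x}

/-- Membership in `regularLocusOfCodim`, by definition. [folklore] -/
theorem mem_regularLocusOfCodim_iff {Z : Set M} {p : ℕ} {x : M} :
    x ∈ regularLocusOfCodim I Z p ↔ x ∈ Z ∧ IsRegularPointOfCodim I Z p x :=
  Iff.rfl

/-- Regular points of codimension `p` are points of `Z`. [folklore] -/
theorem regularLocusOfCodim_subset (Z : Set M) (p : ℕ) : regularLocusOfCodim I Z p ⊆ Z :=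
  fun _ hx => hx.1

/-- Regular points of codimension `p` are regular points. [folklore] -/
theorem regularLocusOfCodim_subset_regularLocus (Z : Set M) (p : ℕ) :
    regularLocusOfCodim I Z p ⊆ regularLocus I Z :=
  fun _ hx => ⟨hx.1, p, hx.2⟩

/-- The regular locus is the union over `p` of the regular loci of codimension `p`. [folklore] -/
theorem regularLocus_eq_iUnion_regularLocusOfCodim (Z : Set M) :
    regularLocus I Z = ⋃ p, regularLocusOfCodim I Z p := by
  ext x
  simp only [regularLocus, mem_setOf_eq, mem_iUnion, mem_regularLocusOfCodim_iff,
    exists_and_left]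

/-- `Z` has pure codimension `p` iff it is a nonempty analytic set all of whose regular points are
regular of codimension `p` (restatement of `HasPureCodim` via `regularLocusOfCodim`). [folklore] -/
theorem hasPureCodim_iff_regularLocus_subset {Z : Set M} {p : ℕ} :
    HasPureCodim I Z p ↔
      IsAnalyticSet I Z ∧ Z.Nonempty ∧ regularLocus I Z ⊆ regularLocusOfCodim I Z p := by
  refine and_congr_right fun _ => and_congr_right fun _ => forall₂_congr fun x hx => ?_
  exact ⟨fun h => ⟨hx.1, h⟩, fun h => h.2⟩

/-- On a manifold modelled on a finite-dimensional space `E`, a regular point of codimension `p`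
has `p ≤ dim E`: the differential `T_x M = E → ℂᵖ` of the defining map is surjective.
[folklore] -/
theorem IsRegularPointOfCodim.le_finrank [FiniteDimensional ℂ E] {Z : Set M} {p : ℕ} {x : M}
    (h : IsRegularPointOfCodim I Z p x) : p ≤ Module.finrank ℂ E := by
  obtain ⟨U, -, -, f, -, -, hf⟩ := h
  let L : E →ₗ[ℂ] (Fin p → ℂ) := (mfderiv I 𝓘(ℂ, Fin p → ℂ) f x).toLinearMap
  have hL : Function.Surjective L := hf
  simpa using LinearMap.finrank_le_finrank_of_surjective hL

/-- In codimension `p > dim E` there are no regular points. [folklore] -/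
theorem regularLocusOfCodim_eq_empty_of_finrank_lt [FiniteDimensional ℂ E] (Z : Set M) {p : ℕ}
    (hp : Module.finrank ℂ E < p) : regularLocusOfCodim I Z p = ∅ :=
  eq_empty_of_forall_notMem fun _ hx => (hx.2.le_finrank.trans_lt hp).false

/-- On a manifold modelled on a finite-dimensional space `E`, the regular locus is the *finite*
union of the regular loci of codimension `p ≤ dim E`. [folklore] -/
theorem regularLocus_eq_biUnion_regularLocusOfCodim [FiniteDimensional ℂ E] (Z : Set M) :
    regularLocus I Z = ⋃ p ∈ Finset.range (Module.finrank ℂ E + 1), regularLocusOfCodim I Z p := by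
  ext x
  simp only [regularLocus, mem_setOf_eq, mem_iUnion, mem_regularLocusOfCodim_iff, Finset.mem_range,
    exists_and_left, exists_prop]
  exact and_congr_right fun _ =>
    ⟨fun ⟨p, hp⟩ => ⟨p, Nat.lt_succ_of_le hp.le_finrank, hp⟩, fun ⟨p, _, hp⟩ => ⟨p, hp⟩⟩

/-! ### Irreducible sets and finite unions; the named fact; the reduction -/

/-- An irreducible analytic set contained in a finite union of analytic sets is contained in one
of them (induction from the binary case in the definition; the union is over a `Finset`, and the
case of an empty union is excluded by nonemptiness of `Z`). [Chirka, §5.3] [folklore] -/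
theorem IsIrreducibleAnalyticSet.exists_subset_of_subset_biUnion {ι : Type*} {Z : Set M}
    (hZ : IsIrreducibleAnalyticSet I Z) (s : Finset ι) {A : ι → Set M}
    (hA : ∀ i ∈ s, IsAnalyticSet I (A i)) (h : Z ⊆ ⋃ i ∈ s, A i) : ∃ i ∈ s, Z ⊆ A i := by
  classical
  induction s using Finset.induction_on with
  | empty =>
    obtain ⟨x, hx⟩ := hZ.2.1
    simpa using h hx
  | insert a s ha ih =>
    rw [Finset.set_biUnion_insert] at h
    rcases hZ.2.2 _ _ (hA a (Finset.mem_insert_self a s))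
        (isAnalyticSet_biUnion_finset s fun i hi => hA i (Finset.mem_insert_of_mem hi)) h with
      h' | h'
    · exact ⟨a, Finset.mem_insert_self a s, h'⟩
    · obtain ⟨i, hi, hZi⟩ := ih (fun i hi => hA i (Finset.mem_insert_of_mem hi)) h'
      exact ⟨i, Finset.mem_insert_of_mem hi, hZi⟩

section Deep

variable (I) (M)

/-- **Decomposition by dimension** [Chirka1989, §5.2 Thm. 1, first assertion]: *let `A` be an
analytic subset of a complex manifold `Ω`; then for any `k ≥ 0` the closure in `Ω` of the set
`A_(k) = {z ∈ A : dim_z A = k}` is either empty or a pure `k`-dimensional analytic subset of `Ω`.*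
Transcription: this file has no notion of local dimension at singular points, but by the proof
of loc. cit. (`cl A_(k) = ⋃ {cl S_j : dim S_j = k}` over the connected components `S_j` of
`reg A`, a locally finite union by [Chirka1989, §5.1 Thm.]) the closure of `A_(k)` equals the
closure of the set of *regular* points of dimension `k`, i.e. of `regularLocusOfCodim I Z p` with
`p = dim M - k`; and "pure `k`-dimensional" is `HasPureCodim · p`. The statement is local on the
ambient manifold, so it is recorded in the generality of this file (chart domains are open subsets
of `ℂⁿ`). The proof in print rests on the theory of analytic covers ([Chirka1989, §§1, 3, 4.3,
5.1]), none of which is in Mathlib. [cite: Chirka1989, §5.2 Thm. 1] -/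
def IsAnalyticSet.hasPureCodim_closure_regularLocusOfCodim : Prop :=
  ∀ [FiniteDimensional ℂ E] [IsManifold I 1 M] [I.Boundaryless] ⦃Z : Set M⦄,
    IsAnalyticSet I Z → ∀ ⦃p : ℕ⦄, (regularLocusOfCodim I Z p).Nonempty →
      HasPureCodim I (closure (regularLocusOfCodim I Z p)) p

end Deep

/-- **Irreducible analytic sets have pure (co)dimension** — the argument of
[Chirka1989, §5.3, p. 54] from its two inputs, stated for a single irreducible `Z`: if the regular
points of `Z` are dense in `Z` (`h₀`, cf. `IsAnalyticSet.subset_closure_regularLocus`) and the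
closure of each nonempty stratum `regularLocusOfCodim I Z p` has pure codimension `p` (`h₁`, cf.
`IsAnalyticSet.hasPureCodim_closure_regularLocusOfCodim`), then `Z` has pure codimension. Proof:
`Z ⊆ cl (reg Z) = ⋃_{p ≤ dim E} cl (reg_p Z)` is a finite union of analytic sets, so by
irreducibility `Z ⊆ cl (reg_p Z) ⊆ Z` for one `p`. Only `[FiniteDimensional ℂ E]` is used (to make
the union finite). [cite: Chirka1989, §5.3] -/
theorem IsIrreducibleAnalyticSet.exists_hasPureCodim_of [FiniteDimensional ℂ E] {Z : Set M}
    (hZ : IsIrreducibleAnalyticSet I Z) (h₀ : Z ⊆ closure (regularLocus I Z))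
    (h₁ : ∀ ⦃p : ℕ⦄, (regularLocusOfCodim I Z p).Nonempty →
      HasPureCodim I (closure (regularLocusOfCodim I Z p)) p) :
    ∃ p, HasPureCodim I Z p := by
  have hZa : IsAnalyticSet I Z := hZ.1
  set n := Module.finrank ℂ E
  -- each closure of a codimension-`p` regular stratum is analytic (empty, or by `h₁`)
  have hcl : ∀ p, IsAnalyticSet I (closure (regularLocusOfCodim I Z p)) := by
    intro p
    rcases (regularLocusOfCodim I Z p).eq_empty_or_nonempty with hp | hp
    · rw [hp, closure_empty]
      exact isAnalyticSet_empty
    · exact (h₁ hp).1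
  -- `Z ⊆ cl (reg Z) = ⋃_{p ≤ n} cl (reg_p Z)`
  have hcover : Z ⊆ ⋃ p ∈ Finset.range (n + 1), closure (regularLocusOfCodim I Z p) := by
    rw [← Finset.closure_biUnion, ← regularLocus_eq_biUnion_regularLocusOfCodim]
    exact h₀
  obtain ⟨p, -, hp⟩ := hZ.exists_subset_of_subset_biUnion _ (fun p _ => hcl p) hcover
  -- hence `reg_p Z ≠ ∅` and `Z = cl (reg_p Z)`
  have hne : (regularLocusOfCodim I Z p).Nonempty := by
    by_contra hcon
    rw [not_nonempty_iff_eq_empty] at hcon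
    obtain ⟨x, hx⟩ := hZ.2.1
    simpa [hcon] using hp hx
  have heq : closure (regularLocusOfCodim I Z p) = Z :=
    (hZa.isClosed.closure_subset_iff.2 (regularLocusOfCodim_subset Z p)).antisymm hp
  exact ⟨p, heq ▸ h₁ hne⟩

variable (I) (M) in
/-- **Reduction of `IsIrreducibleAnalyticSet.exists_hasPureCodim` to named facts**: the pure
dimension of irreducible analytic sets follows from the density of regular points
(`IsAnalyticSet.subset_closure_regularLocus`, [Chirka1989, §2.3 Thm.]) and the decomposition by
dimension (`IsAnalyticSet.hasPureCodim_closure_regularLocusOfCodim`, [Chirka1989, §5.2 Thm. 1]),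
exactly as in [Chirka1989, §5.3, p. 54]. (To feed a named fact `h : <fact> I M` to a lemma
expecting the same fact, write `@h`: the facts unfold to `∀ [inst…] ⦃Z⦄, …` and the implicit-lambda
feature otherwise gets in the way.) [cite: Chirka1989, §5.3] -/
theorem IsIrreducibleAnalyticSet.exists_hasPureCodim_of_facts
    (h₀ : IsAnalyticSet.subset_closure_regularLocus I M)
    (h₁ : IsAnalyticSet.hasPureCodim_closure_regularLocusOfCodim I M) :
    IsIrreducibleAnalyticSet.exists_hasPureCodim I M := by
  intro _ _ _ Z hZ
  exact hZ.exists_hasPureCodim_of (h₀ hZ.1) fun _ hp => h₁ hZ.1 hp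

end Literature.Geometry.Kaehler
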